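import Summits.Ventures.PercRepro.RankLevelSetIndepSRISum
import Summits.Ventures.PercRepro.RankLevelSetIndepSRITruncate
import Summits.Ventures.PercRepro.RankLevelSetIndepCDModel

/-! # RankLevelSetIndepSRIModel — (SRI) ON EVERY UNIFORM MATROID, AND ON THE MODEL FAMILY FOR EVERY CROSS PAIR
(night-1 g28; dossier §40)

For the uniform matroid `U_{p,E} = modelMatroid hE ∅ q p` the `(y, e)`-slices are windowed binomial rows
`I_k^A = C(#E − 2, k)` for `k + #A ≤ p` (else `0`) (`sliceCount_uniform`), so (SRI) holds with equality inside the
window: **`indepSRI_uniform`**. For the model `T_r(U_{q,F} ⊕ U_{D,D})` (`modelMatroid hE F q r`) and a CROSS pair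
`y ∈ F`, `e ∈ E ∖ F`: the model is the truncation of the disjoint sum of two uniform matroids
(`modelMatroid_eq_truncateTo_disjointSum`), (CD) holds on both uniform summands (`indepCD_uniform`), the cross (SRI)
of a disjoint sum follows from (CD) of the summands (`indepSRI_cross_disjointSum`), and the slices of a truncation are
windows (`sliceCount_truncateTo`): **`indepSRI_cross_modelMatroid`**. (The within-summand pairs of the model need the
log-concavity of partial sums of binomial convolutions and are not done here.) Every declaration has a docstring;
imports: the cell's own modules and Mathlib only. Axioms: standard. -/

namespace PercRepro

open Set Matroid

variable {α : Type}

/-- **The slices of a uniform matroid are windowed binomial rows**: for `A ⊆ {y, e}` (`y ≠ e` in `E`),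
`I_k^A = C(#E − 2, k)` if `k + #A ≤ p`, else `0`. -/
lemma sliceCount_uniform {E : Set α} (hE : E.Finite) (q p : ℕ) {y e : α} (hy : y ∈ E) (he : e ∈ E) (hye : y ≠ e)
    {A : Set α} (hA : A ⊆ {y, e}) (k : ℕ) :
    sliceCount (modelMatroid hE ∅ q p) y e A k = if k + A.ncard ≤ p then (E.ncard - 2).choose k else 0 := by
  unfold sliceCount
  simp only [modelMatroid_E, uniform_indep_iff]
  have hE' : (E \ {y, e}).Finite := hE.subset Set.sdiff_subset
  have hAfin : A.Finite := (Set.toFinite {y, e}).subset hA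
  have hcard : ∀ T : Set α, T ⊆ E \ {y, e} → T.ncard = k → (T ∪ A).ncard = k + A.ncard := by
    intro T hTE hT
    have hdisj : Disjoint T A := by
      rw [Set.disjoint_left]
      intro x hxT hxA
      exact (hTE hxT).2 (hA hxA)
    rw [Set.ncard_union_eq hdisj (hE'.subset hTE) hAfin, hT]
  have hcount : (E \ {y, e}).ncard = E.ncard - 2 := by
    rw [Set.ncard_sdiff' (Set.insert_subset hy (Set.singleton_subset_iff.mpr he)) hE, Set.ncard_pair hye]
  split_ifs with hkp
  · rw [← hcount, ← ncard_subsets_of_finite hE' k]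
    congr 1
    ext T
    simp only [Set.mem_setOf_eq]
    constructor
    · rintro ⟨hTE, hT, -⟩; exact ⟨hTE, hT⟩
    · rintro ⟨hTE, hT⟩
      refine ⟨hTE, hT, Set.union_subset (hTE.trans Set.sdiff_subset) (hA.trans ?_), ?_⟩
      · exact Set.insert_subset hy (Set.singleton_subset_iff.mpr he)
      · rw [hcard T hTE hT]; exact hkp
  · rw [Set.ncard_eq_zero (hE'.finite_subsets.subset (fun T hT => hT.1))]
    ext T
    simp only [Set.mem_setOf_eq, Set.mem_empty_iff_false, iff_false, not_and]
    intro hTE hT _ hle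
    rw [hcard T hTE hT] at hle
    exact hkp hle

/-- **(SRI) holds on every uniform matroid** (equality inside the window, a zero factor outside). -/
theorem indepSRI_uniform {E : Set α} (hE : E.Finite) (q p : ℕ) : IndepSRI (modelMatroid hE ∅ q p) := by
  intro y hy e he hye k
  rw [modelMatroid_E] at hy he
  rw [sliceCount_uniform hE q p hy he hye (Set.empty_subset _), sliceCount_uniform hE q p hy he hye (subset_refl _),
    sliceCount_uniform hE q p hy he hye (Set.singleton_subset_iff.mpr (by simp)),
    sliceCount_uniform hE q p hy he hye (Set.singleton_subset_iff.mpr (by simp)), Set.ncard_empty,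
    Set.ncard_pair hye, Set.ncard_singleton, Set.ncard_singleton]
  by_cases hkp : k + 2 ≤ p
  · simp only [if_pos (show k + 0 ≤ p by omega), if_pos hkp, if_pos (show k + 1 ≤ p by omega), le_refl]
  · rw [if_neg hkp, mul_zero]
    exact Nat.zero_le _

/-- **(SRI) HOLDS ON THE MODEL FAMILY FOR EVERY CROSS PAIR** `y ∈ F`, `e ∈ E ∖ F`: `I_k^∅ · I_k^{ye} ≤ I_k^y · I_k^e` in
`modelMatroid hE F q r` for every `k`. -/
theorem indepSRI_cross_modelMatroid {E : Set α} (hE : E.Finite) {F : Set α} (hF : F ⊆ E) (q r : ℕ) {y e : α}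
    (hy : y ∈ F) (he : e ∈ E \ F) (k : ℕ) :
    sliceCount (modelMatroid hE F q r) y e ∅ k * sliceCount (modelMatroid hE F q r) y e {y, e} k ≤
      sliceCount (modelMatroid hE F q r) y e {y} k * sliceCount (modelMatroid hE F q r) y e {e} k := by
  haveI := modelMatroid_finite (hE.subset hF) ∅ q q
  haveI := modelMatroid_finite ((hE.subset (Set.sdiff_subset : E \ F ⊆ E))) ∅ (E \ F).ncard (E \ F).ncard
  have hdisj : Disjoint (modelMatroid (hE.subset hF) ∅ q q).E
      (modelMatroid ((hE.subset (Set.sdiff_subset : E \ F ⊆ E))) ∅ (E \ F).ncard (E \ F).ncard).E :=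
    Set.disjoint_sdiff_right
  haveI hfin : ((modelMatroid (hE.subset hF) ∅ q q).disjointSum
      (modelMatroid ((hE.subset (Set.sdiff_subset : E \ F ⊆ E))) ∅ (E \ F).ncard (E \ F).ncard) hdisj).Finite :=
    ⟨by rw [Matroid.disjointSum_ground_eq, modelMatroid_E, modelMatroid_E]
        exact (hE.subset hF).union ((hE.subset (Set.sdiff_subset : E \ F ⊆ E)))⟩
  have hye : y ≠ e := fun h => he.2 (h ▸ hy)
  rw [modelMatroid_eq_truncateTo_disjointSum hE hF q r]
  rw [sliceCount_truncateTo _ y e (Set.empty_subset _), sliceCount_truncateTo _ y e (subset_refl _),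
    sliceCount_truncateTo _ y e (Set.singleton_subset_iff.mpr (by simp)),
    sliceCount_truncateTo _ y e (Set.singleton_subset_iff.mpr (by simp)), Set.ncard_empty,
    Set.ncard_pair hye, Set.ncard_singleton, Set.ncard_singleton]
  by_cases hkr : k + 2 ≤ r
  · rw [if_pos (by omega), if_pos hkr, if_pos (by omega), if_pos (by omega)]
    exact indepSRI_cross_disjointSum _ _ hdisj (indepCD_uniform (hE.subset hF) q q)
      (indepCD_uniform ((hE.subset (Set.sdiff_subset : E \ F ⊆ E))) _ _) (by rw [modelMatroid_E]; exact hy)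
      (by rw [modelMatroid_E]; exact he) k
  · rw [if_neg hkr, mul_zero]
    exact Nat.zero_le _

end PercRepro
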